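import Literature.Geometry.ComplexHyperbolic.UnitBallQuotientManifold
import Literature.Geometry.ComplexHyperbolic.UnitBallInvariantMeasure
import HarnessLib

/-!
# Cocompact subgroups of `U(2,1)` ⟺ compact ball quotients `Δ\𝔹²`

Continuation of `UnitBallQuotientManifold.lean` (the orbit space `Δ\𝔹² = orbitRel.Quotient Δ Ball` of a
subgroup `Δ ≤ U(2,1) = BallModel.U21` acting on the tree's affine ball `BallModel.Ball = 𝔹² ⊂ ℂ²`) and
`UnitBallInvariantMeasure.lean` (PROPERNESS of the orbit map `g ↦ g·0`, `isCompact_setOf_smul_x₀_mem`).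

For a subgroup `Δ ≤ U(2,1)`:

* `BallModel.compactSpace_quotient_of_compactSpace_quotientGroup` (tree, `UnitBallQuotientManifold.lean`):
  `Δ` COCOMPACT in `U(2,1)` (`CompactSpace (U21 ⧸ Δ)`) ⇒ `Δ\𝔹²` compact;
* **here, the converse** `compactSpace_quotientGroup_of_compactSpace_quotient`: `Δ\𝔹²` compact ⇒
  `U(2,1)/Δ` compact. Proof: a compact quotient of the locally compact ball is the image of a compact
  `C ⊆ 𝔹²` (`exists_isCompact_forall_exists_mk_eq`: the projection is open, take a finite subcover of the
  images of compact neighbourhoods); the set `S = {g | g⁻¹·0 ∈ C}` is compact by properness of the orbit map,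
  and `g ↦ gΔ` maps `S` onto `U(2,1)/Δ` (if `g⁻¹·0 = δ·c` with `δ ∈ Δ`, `c ∈ C`, then `gδ ∈ S`);
* packaged as the equivalence `compactSpace_quotientGroup_iff_compactSpace_quotient`.

This is the standard equivalence «`Γ\G` compact ⟺ `Γ\G/K` compact» for the compact isotropy group
`K = Stab(0) ≅ U(2) × U(1)`; it lets statements about compact quotients `Δ\𝔹²` hypothesised with either
binder (`[CompactSpace (U21 ⧸ Δ)]` as in the tree's Poincaré-series / projective-embedding files, or
`[CompactSpace (orbitRel.Quotient Δ Ball)]` as in the record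
`ShimuraVarieties.compactBallQuotient_projectiveEmbedding`) be used interchangeably.

References: N. Bergeron, J. Millson, C. Moeglin, Acta Math. 216 (2016), Introduction §1.1 (`S(Γ) = Γ\X`
compact for cocompact `Γ`); S. Helgason, *Groups and Geometric Analysis* (2000), Ch. I §1 (coset spaces
`G/H`, `H` compact); A. Borel, *Introduction aux groupes arithmétiques* (1969), §1. Everything below is
PROVED. [folklore]
-/

set_option autoImplicit false

noncomputable section

open Set Function MulAction Topology

namespace Literature.Geometry.ComplexHyperbolic

namespace BallModel

section Subgroup

variable (Δ : Subgroup U21)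

/-- **Compact exhaustion of a compact quotient**: if `Δ\𝔹²` is compact, some compact `C ⊆ 𝔹²` meets every
`Δ`-orbit, i.e. maps onto `Δ\𝔹²` (the projection `𝔹² → Δ\𝔹²` is open and `𝔹²` is locally compact: finitely
many images of compact neighbourhoods cover the quotient).
[cite: BergeronMillsonMoeglin2016Balls, Introduction §1.1] -/
theorem exists_isCompact_forall_exists_mk_eq [CompactSpace (orbitRel.Quotient Δ Ball)] :
    ∃ C : Set Ball, IsCompact C ∧ ∀ q : orbitRel.Quotient Δ Ball, ∃ z ∈ C,
      Literature.Geometry.Manifold.QuotientManifold.mk (G := Δ) z = q := by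
  classical
  have hopen : IsOpenMap (Literature.Geometry.Manifold.QuotientManifold.mk (G := Δ) (M := Ball)) :=
    isOpenMap_quotient_mk'_mul
  choose K hKc hKn using fun z : Ball ↦ exists_compact_mem_nhds z
  obtain ⟨t, -, ht⟩ := (isCompact_univ (X := orbitRel.Quotient Δ Ball)).elim_nhds_subcover
    (fun q ↦ Literature.Geometry.Manifold.QuotientManifold.mk (G := Δ) '' K q.out) fun q _ ↦ by
      have h := hopen.image_mem_nhds (hKn q.out)
      rwa [show Literature.Geometry.Manifold.QuotientManifold.mk (G := Δ) q.out = q from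
        Quotient.out_eq q] at h
  refine ⟨⋃ q ∈ t, K q.out, t.isCompact_biUnion fun q _ ↦ hKc _, fun q ↦ ?_⟩
  obtain ⟨q', hq't, z, hzK, rfl⟩ := mem_iUnion₂.1 (ht (mem_univ q))
  exact ⟨z, mem_iUnion₂.2 ⟨q', hq't, hzK⟩, rfl⟩

/-- For compact `C ⊆ 𝔹²` the set `{g ∈ U(2,1) | g⁻¹·0 ∈ C}` is compact (properness of the orbit map,
`isCompact_setOf_smul_x₀_mem`, composed with inversion). [cite: Helgason2000, Ch. I §1 No. 2, Theorem 1.9] -/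
theorem isCompact_setOf_inv_smul_x₀_mem {C : Set Ball} (hC : IsCompact C) :
    IsCompact {g : U21 | g⁻¹ • x₀ ∈ C} := by
  have h2 : {g : U21 | g⁻¹ • x₀ ∈ C} = (fun g : U21 ↦ g⁻¹) '' {g : U21 | g • x₀ ∈ C} := by
    ext g
    constructor
    · intro hg
      exact ⟨g⁻¹, hg, inv_inv g⟩
    · rintro ⟨h, hh, rfl⟩
      simpa only [mem_setOf_eq, inv_inv] using hh
  rw [h2]
  exact (isCompact_setOf_smul_x₀_mem hC).image continuous_inv

/-- **Compact quotient ⇒ cocompact**: if `Δ\𝔹²` is compact then `U(2,1)/Δ` is compact — converse of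
the tree's `compactSpace_quotient_of_compactSpace_quotientGroup`. With `C ⊆ 𝔹²` compact mapping onto
`Δ\𝔹²`, the compact set `S = {g | g⁻¹·0 ∈ C}` maps onto `U(2,1)/Δ` under `g ↦ gΔ`: for any `g`, writing
`g⁻¹·0 = δ·c` (`δ ∈ Δ`, `c ∈ C`) gives `gδ⁻¹… ` precisely `(g δ⁻¹)⁻¹·0 = c`, and `(gδ⁻¹)Δ = gΔ`.
[cite: BergeronMillsonMoeglin2016Balls, Introduction §1.1] -/
theorem compactSpace_quotientGroup_of_compactSpace_quotient [CompactSpace (orbitRel.Quotient Δ Ball)] :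
    CompactSpace (U21 ⧸ Δ) := by
  obtain ⟨C, hC, hsurj⟩ := exists_isCompact_forall_exists_mk_eq Δ
  have hS : IsCompact {g : U21 | g⁻¹ • x₀ ∈ C} := isCompact_setOf_inv_smul_x₀_mem hC
  have hrange : range (fun s : {g : U21 | g⁻¹ • x₀ ∈ C} ↦ (QuotientGroup.mk (s : U21) : U21 ⧸ Δ)) =
      univ := by
    refine eq_univ_of_forall fun q ↦ ?_
    obtain ⟨g, rfl⟩ := QuotientGroup.mk_surjective q
    obtain ⟨z, hzC, hz⟩ := hsurj (Literature.Geometry.Manifold.QuotientManifold.mk (G := Δ) (g⁻¹ • x₀))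
    obtain ⟨δ, hδ⟩ := MulAction.mem_orbit_iff.1 (MulAction.orbitRel_apply.1 (Quotient.exact hz))
    refine ⟨⟨g * (δ : U21)⁻¹, ?_⟩, ?_⟩
    · show (g * (δ : U21)⁻¹)⁻¹ • x₀ ∈ C
      rw [mul_inv_rev, inv_inv, mul_smul, ← Subgroup.smul_def, hδ]
      exact hzC
    · show (QuotientGroup.mk (g * (δ : U21)⁻¹) : U21 ⧸ Δ) = QuotientGroup.mk g
      rw [QuotientGroup.eq, mul_inv_rev, inv_inv, mul_assoc, inv_mul_cancel, mul_one]
      exact δ.2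
  haveI : CompactSpace {g : U21 | g⁻¹ • x₀ ∈ C} := isCompact_iff_compactSpace.1 hS
  exact ⟨by rw [← hrange]; exact isCompact_range (continuous_quotient_mk'.comp continuous_subtype_val)⟩

/-- **Cocompact ⟺ compact quotient** for a subgroup `Δ ≤ U(2,1)` acting freely and properly
discontinuously on `𝔹²` (the binders are those of the tree's direction
`compactSpace_quotient_of_compactSpace_quotientGroup`; the converse needs none).
[cite: BergeronMillsonMoeglin2016Balls, Introduction §1.1] -/
theorem compactSpace_quotientGroup_iff_compactSpace_quotient [ProperlyDiscontinuousSMul Δ Ball]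
    [IsCancelSMul Δ Ball] : CompactSpace (U21 ⧸ Δ) ↔ CompactSpace (orbitRel.Quotient Δ Ball) :=
  ⟨fun _ ↦ compactSpace_quotient_of_compactSpace_quotientGroup Δ,
    fun _ ↦ compactSpace_quotientGroup_of_compactSpace_quotient Δ⟩

end Subgroup

end BallModel

end Literature.Geometry.ComplexHyperbolic

end
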